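import Literature.NumberTheory.EllipticCurves.PastenValuationProductLemma610Proofs
import Literature.NumberTheory.DiophantineGeometry.AbcDarmonGranvilleOfFaltings
import Literature.NumberTheory.DiophantineGeometry.AbcDarmonGranvilleSignatureReduction
import HarnessLib

/-!
# Pasten's Lemma 6.10 from Faltings' theorem and the `(p, q, r)`-covering fact

Topic `NumberTheory/EllipticCurves`; namespace `Literature.NumberTheory.EllipticCurves`.
Theorem-only file (no new facts): the composition of the ACCEPTED conditional proof
`PastenShimura2024_lemma_6_10_of_darmonGranville1995_thm_2`
(`PastenValuationProductLemma610Proofs.lean`: Pasten's Lemma 6.10 from Darmon–Granville's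
Theorem 2, following the printed proof of [PastenShimura2024, §6.5, p. 22]) with the ACCEPTED
assembly `darmonGranville1995_thm_2_of_faltings` (`AbcDarmonGranvilleOfFaltings.lean`:
Darmon–Granville's Theorem 2 from Faltings' theorem `finite_ratPlaces_of_two_le_genus` and the
Riemann-existence covering fact `exists_signatureCover_numberField`). It records the exact root
dependencies of the named fact `PastenShimura2024_lemma_6_10` (`PastenValuationProduct.lean`) in the
tree: the fact — and the stronger finiteness form `h610` consumed by
`Literature.NumberTheory.Automorphic.PastenShimura2024_thm_6_17'` — is closed MODULO Faltings'
theorem and the `(p, q, r)`-covering fact alone, and `PastenShimura2024_lemma_6_10_holds` is the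
one-liner `PastenShimura2024_lemma_6_10_of_faltings exists_signatureCover_numberField_holds
(fun K _ F _ _ => finite_ratPlaces_of_two_le_genus_holds K F)` once those two facts are discharged.
Kept in its own file so that the proofs sibling does not import the function-field closure of the
Darmon–Granville reduction.

## The covering input, cut down to the signatures `(2, 3, r)` (§2 of this file)

The printed proof of Lemma 6.10 applies Darmon–Granville's theorem only to the equations
`A x^L + B y² = C z³`, i.e. at the ONE signature `(L, 2, 3)` (`PastenLemma610.conductor_bounded_of_
finite_properSolutions`, `PastenLemma610.finite_minimalDiscriminantNorm_of_finite_properSolutions` of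
the proofs sibling take exactly that finiteness as hypothesis). By the tree's per-signature form of
Theorem 2 (`finite_properSolutions_of_belyiMap_of_faltings`, `AbcDarmonGranvilleSignatureReduction`:
ONE covering of `ℙ¹` of signature `(p, q, r)` over a number field and Faltings' theorem give
finiteness for all non-zero `A, B, C`) together with its elementary reductions (permuting the
signature, `finite_properSolutions_swap₁₂/₂₃`; passing from `(r, 2, 3)` to `(L, 2, 3)` for `r ∣ L`
by `x ↦ x^{L/r}`, `finite_properSolutions_of_dvd`), the Riemann-existence input that Lemma 6.10
really needs is therefore: **for each `L ≥ 7`, ONE covering of signature `(2, 3, r)` for ONE divisor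
`r ≥ 7` of `L`** — equivalently, coverings of signature `(2, 3, r)` for the `r ≥ 7` none of whose
proper divisors is `≥ 7` (the primes `ℓ ≥ 7` and `8, 9, 10, 12, 15, 25, …`; these are exactly the
sorted hyperbolic signatures `(2, 3, r)` minimal for coordinatewise divisibility in the sense of
`darmonGranville1995_thm_2_of_minimal_belyiMaps_of_faltings`). This is recorded as

* `PastenLemma610.finite_properSolutions_of_cover_of_faltings` — finiteness of the proper solutions
  of `A x^L + B y² = C z³` from one `(2, 3, r)` covering with `r ∣ L`, `r ≥ 7`, and Faltings;
* `PastenShimura2024_lemma_6_10_of_signatureCovers_two_three_of_faltings`,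
  `finite_minimalDiscriminantNorm_of_signatureCovers_two_three_of_faltings` — the fact, resp. its
  finiteness form `h610`, from Faltings' theorem and `(2, 3, r)` coverings for the minimal `r ≥ 7`
  only; `…_of_minimal_belyiMaps_of_faltings` — the same fed by the binder `hCover` of
  `darmonGranville1995_thm_2_of_minimal_belyiMaps_of_faltings` (all minimal sorted signatures);
* `PastenLemma610.conductor_bounded_of_cover_two_three_seven_of_faltings` — for the exponents
  `L` divisible by `7`, Lemma 6.10 follows from Faltings' theorem and ONE covering of signature
  `(2, 3, 7)` (e.g. Klein's quartic with its function of degree `168`, or any `(2, 3, 7)` Belyi map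
  of genus `≥ 2`; not in the tree).

For the family `(2, 3, r)`, `r ≥ 7`, the monodromy of any such covering is a non-trivial quotient of
the perfect triangle group `Δ(2, 3, r)` when `gcd(r, 6) = 1`, so no Kummer/radical tower over `K(t)`
supplies it; the classical source for all `r` at once is the modular curve `X(r) → X(1)` (the
`j`-function, ramified of index `2, 3, r` over `j = 1728, 0, ∞`), i.e. again a theory the tree does
not have. Nothing here changes a statement elsewhere; no definition is introduced.

## References

* H. Pasten, *Shimura curves and the abc conjecture*, J. Number Theory 254 (2024) 214–335
  (arXiv:1705.09251), §6.5, Lemma 6.10 (held text p. 22). [PastenShimura2024]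
* H. Darmon, A. Granville, *On the equations `z^m = F(x, y)` and `A x^p + B y^q = C z^r`*, Bull.
  London Math. Soc. 27 (1995) 513–543, Theorem 2 (p. 515), Prop. 3.1 (p. 525), proof of Theorem 2
  (pp. 526–527). [DarmonGranville1995]
* G. Faltings, *Endlichkeitssätze für abelsche Varietäten über Zahlkörpern*, Invent. Math. 73
  (1983), §6 Satz 7. [Faltings1983Endlichkeit]
* E. Bombieri, W. Gubler, *Heights in Diophantine Geometry*, CUP 2006: Cor. 12.6.7, Thm. 12.6.15.
  [BombieriGubler2006]
-/

noncomputable section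

open scoped Polynomial

namespace Literature.NumberTheory.EllipticCurves

open Literature.NumberTheory.DiophantineGeometry Polynomial AlgFunctionField

/-! ### 1. From the global covering fact (Riemann existence) and Faltings' theorem -/

/-- **Pasten's Lemma 6.10 from Faltings' theorem and the `(p, q, r)`-covering fact**: the named
fact `PastenShimura2024_lemma_6_10` follows from `exists_signatureCover_numberField`
(Bombieri–Gubler Cor. 12.6.7/12.6.8 = Darmon–Granville Prop. 3.1) and Faltings' theorem in the
tree's function-field form, through Darmon–Granville's Theorem 2.
[cite: PastenShimura2024, Lemma 6.10 (§6.5, p. 22)]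
[cite: DarmonGranville1995, Theorem 2 (p. 515)] -/
theorem PastenShimura2024_lemma_6_10_of_faltings (hRET : exists_signatureCover_numberField)
    (hFaltings : ∀ (K' : Type) [Field K'] (F' : Type) [Field F'] [Algebra K' F'],
      finite_ratPlaces_of_two_le_genus K' F') :
    PastenShimura2024_lemma_6_10 :=
  PastenShimura2024_lemma_6_10_of_darmonGranville1995_thm_2
    (darmonGranville1995_thm_2_of_faltings hRET hFaltings)

/-- **The finiteness form of Lemma 6.10 (the hypothesis `h610` of `PastenShimura2024_thm_6_17'`)
from Faltings' theorem and the `(p, q, r)`-covering fact**: for fixed `S` and `L ≥ 7` the set of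
minimal discriminants `|Δ_E|` of the elliptic curves `E/ℚ` semi-stable away from `S` with
`|Δ_E| = n k^L`, all primes of `n` in `S`, is finite.
[cite: PastenShimura2024, Lemma 6.10 (§6.5, p. 22), last paragraph of the proof] -/
theorem finite_minimalDiscriminantNorm_of_faltings (hRET : exists_signatureCover_numberField)
    (hFaltings : ∀ (K' : Type) [Field K'] (F' : Type) [Field F'] [Algebra K' F'],
      finite_ratPlaces_of_two_le_genus K' F') (S : Finset ℕ) :
    ∀ L : ℕ, 7 ≤ L → {Δ : ℕ | ∃ (W : WeierstrassCurve ℚ) (_ : W.IsElliptic),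
        (∀ q : ℕ, q.Prime → q ∉ S → ¬ q ^ 2 ∣ W.conductorNorm ℤ) ∧
        W.minimalDiscriminantNorm ℤ = Δ ∧
        ∃ n k : ℕ, (∀ q : ℕ, q.Prime → q ∣ n → q ∈ S) ∧ Δ = n * k ^ L}.Finite :=
  finite_minimalDiscriminantNorm_of_darmonGranville1995_thm_2
    (darmonGranville1995_thm_2_of_faltings hRET hFaltings) S

/-! ### 2. From coverings of the signatures `(2, 3, r)` only, and Faltings' theorem -/

/-- **The Diophantine input of Lemma 6.10 from ONE covering of signature `(2, 3, r)`, `r ∣ L`,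
`r ≥ 7`, and Faltings' theorem.** Let `K` be a number field, `F/K` an algebraic function field with
full constant field `K` and `f ∈ F ∖ K` with every zero of order `2`, every zero of `f - 1` of order
`3`, every pole of order `r`, and `F/K(f)` unramified over the other closed points of the `f`-line;
grant Faltings' theorem (every function field over a number field). Then for `L ≠ 0` divisible by
`r` and all non-zero `A, B, C` the proper solutions of `A x^L + B y² = C z³` are finitely many.
Proof: `(2, 3, r)` is hyperbolic iff `r ≥ 7`; the per-signature Darmon–Granville theorem
`finite_properSolutions_of_belyiMap_of_faltings` gives finiteness at `(2, 3, r)` for all coefficients,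
the permutations `finite_properSolutions_swap₂₃`, `…swap₁₂` carry it to `(r, 2, 3)`, and
`x ↦ x^{L/r}` (`finite_properSolutions_of_dvd`) to `(L, 2, 3)`.
[cite: DarmonGranville1995, Theorem 2 (p. 515); proof, pp. 526–527]
[cite: PastenShimura2024, Lemma 6.9 and Lemma 6.10 (§6.5, p. 22)] -/
theorem PastenLemma610.finite_properSolutions_of_cover_of_faltings {r L : ℕ} (hr : 7 ≤ r)
    (hrL : r ∣ L) (hL : L ≠ 0)
    {K : Type} [Field K] [NumberField K] {F : Type} [Field F] [Algebra K F]
    [IsAlgFunctionField K F] [IsIntegrallyClosedIn K F] {f : F}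
    (hf : f ∉ Set.range (algebraMap K F))
    (h₀ : ∀ P : PlaceOver K F, 0 < P.ord f → P.ord f = 2)
    (h₁ : ∀ P : PlaceOver K F, 0 < P.ord (f - 1) → P.ord (f - 1) = 3)
    (hi : ∀ P : PlaceOver K F, P.ord f < 0 → P.ord f = -r)
    (hunr : ∀ π₀ : K[X], Irreducible π₀ → π₀.Monic → π₀ ≠ X → π₀ ≠ X - 1 →
      ∀ P : PlaceOver K F, 0 < P.ord (aeval f π₀) → P.ord (aeval f π₀) = 1)
    (hFaltings : ∀ (K' : Type) [Field K'] (F' : Type) [Field F'] [Algebra K' F'],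
      finite_ratPlaces_of_two_le_genus K' F')
    {A B C : ℤ} (hA : A ≠ 0) (hB : B ≠ 0) (hC : C ≠ 0) :
    {t : ℤ × ℤ × ℤ | ({t.1, t.2.1, t.2.2} : Finset ℤ).gcd id = 1 ∧
      A * t.1 ^ L + B * t.2.1 ^ 2 = C * t.2.2 ^ 3}.Finite := by
  -- `(2, 3, r)` is hyperbolic
  have hhyp : 3 * r + r * 2 + 2 * 3 < 2 * 3 * r := by omega
  -- Theorem 2 at the signature `(2, 3, r)`, all coefficients
  have h23r : ∀ A B C : ℤ, A ≠ 0 → B ≠ 0 → C ≠ 0 →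
      {t : ℤ × ℤ × ℤ | ({t.1, t.2.1, t.2.2} : Finset ℤ).gcd id = 1 ∧
        A * t.1 ^ 2 + B * t.2.1 ^ 3 = C * t.2.2 ^ r}.Finite :=
    fun A B C hA hB hC =>
      finite_properSolutions_of_belyiMap_of_faltings hhyp hf h₀ h₁ hi hunr hFaltings hA hB hC
  -- carried to `(r, 2, 3)`: `(2, 3, r) → (2, r, 3) → (r, 2, 3)`
  have hr23 : ∀ A B C : ℤ, A ≠ 0 → B ≠ 0 → C ≠ 0 →
      {t : ℤ × ℤ × ℤ | ({t.1, t.2.1, t.2.2} : Finset ℤ).gcd id = 1 ∧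
        A * t.1 ^ r + B * t.2.1 ^ 2 = C * t.2.2 ^ 3}.Finite :=
    forall_finite_properSolutions_swap₁₂ (forall_finite_properSolutions_swap₂₃ h23r)
  -- and to `(L, 2, 3)` by `x ↦ x^{L/r}`
  exact finite_properSolutions_of_dvd hrL dvd_rfl dvd_rfl hL two_ne_zero three_ne_zero
    (hr23 A B C hA hB hC)

/-- **Lemma 6.10 for the exponents divisible by `7`, from ONE covering of signature `(2, 3, 7)` and
Faltings' theorem** (conductor form, at one exponent): if `K` is a number field and `F/K`, `f` a
covering of the `f`-line of signature `(2, 3, 7)` as above, and Faltings' theorem is granted, then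
for every `L ≠ 0` with `7 ∣ L` and every finite `S` there is `N₀` such that no elliptic curve `E/ℚ`
semi-stable away from `S` with `N_E ≥ N₀` has `|Δ_E| = n k^L` with all primes of `n` in `S`. The
one remaining Riemann-existence input for these exponents is thus a single explicit curve (Klein's
quartic `x³y + y³z + z³x = 0` with its quotient map by `PSL₂(𝔽₇)`, of degree `168`, is one).
[cite: PastenShimura2024, Lemma 6.10 (§6.5, p. 22)]
[cite: DarmonGranville1995, Theorem 2 (p. 515)] -/
theorem PastenLemma610.conductor_bounded_of_cover_two_three_seven_of_faltings
    {K : Type} [Field K] [NumberField K] {F : Type} [Field F] [Algebra K F]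
    [IsAlgFunctionField K F] [IsIntegrallyClosedIn K F] {f : F}
    (hf : f ∉ Set.range (algebraMap K F))
    (h₀ : ∀ P : PlaceOver K F, 0 < P.ord f → P.ord f = 2)
    (h₁ : ∀ P : PlaceOver K F, 0 < P.ord (f - 1) → P.ord (f - 1) = 3)
    (hi : ∀ P : PlaceOver K F, P.ord f < 0 → P.ord f = -7)
    (hunr : ∀ π₀ : K[X], Irreducible π₀ → π₀.Monic → π₀ ≠ X → π₀ ≠ X - 1 →
      ∀ P : PlaceOver K F, 0 < P.ord (aeval f π₀) → P.ord (aeval f π₀) = 1)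
    (hFaltings : ∀ (K' : Type) [Field K'] (F' : Type) [Field F'] [Algebra K' F'],
      finite_ratPlaces_of_two_le_genus K' F')
    {L : ℕ} (hL : L ≠ 0) (h7 : 7 ∣ L) (S : Finset ℕ) :
    ∃ N₀ : ℕ, ∀ (W : WeierstrassCurve ℚ) [W.IsElliptic],
      (∀ p : ℕ, p.Prime → p ∉ S → ¬ p ^ 2 ∣ W.conductorNorm ℤ) → N₀ ≤ W.conductorNorm ℤ →
      ∀ n k : ℕ, n.primeFactors ⊆ S → W.minimalDiscriminantNorm ℤ ≠ n * k ^ L :=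
  have h7L : 7 ≤ L := Nat.le_of_dvd (Nat.pos_of_ne_zero hL) h7
  PastenLemma610.conductor_bounded_of_finite_properSolutions (by omega)
    (fun _ _ _ hA hB hC => PastenLemma610.finite_properSolutions_of_cover_of_faltings le_rfl h7
      hL hf h₀ h₁ (by exact_mod_cast hi) hunr hFaltings hA hB hC) S

/-- **Pasten's Lemma 6.10 from Faltings' theorem and coverings of the signatures `(2, 3, r)` for the
minimal `r ≥ 7` only.** Suppose that for every `r ≥ 7` none of whose proper divisors is `≥ 7` there
are a number field `K`, an algebraic function field `F/K` with full constant field `K` and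
`f ∈ F ∖ K` with every zero of order `2`, every zero of `f - 1` of order `3`, every pole of order `r`,
and `F/K(f)` unramified over the other closed points of the `f`-line (the covering of
[cite: DarmonGranville1995, Prop. 3.1 (p. 525)] = [cite: BombieriGubler2006, Cor. 12.6.7] at the
signature `(2, 3, r)`), and grant Faltings' theorem. Then `PastenShimura2024_lemma_6_10` holds.
Proof: for `L ≥ 7` let `r` be the least divisor `≥ 7` of `L`; it is minimal in the above sense, and
`PastenLemma610.finite_properSolutions_of_cover_of_faltings` feeds
`PastenLemma610.conductor_bounded_of_finite_properSolutions`.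
[cite: PastenShimura2024, Lemma 6.10 (§6.5, p. 22)]
[cite: DarmonGranville1995, Theorem 2 (p. 515), Prop. 3.1 (p. 525)] -/
theorem PastenShimura2024_lemma_6_10_of_signatureCovers_two_three_of_faltings
    (hCover : ∀ r : ℕ, 7 ≤ r → (∀ r' : ℕ, r' ∣ r → 7 ≤ r' → r' = r) →
      ∃ (K : Type) (_ : Field K) (_ : NumberField K) (F : Type) (_ : Field F) (_ : Algebra K F)
        (_ : IsAlgFunctionField K F) (_ : IsIntegrallyClosedIn K F) (f : F),
        f ∉ Set.range (algebraMap K F) ∧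
        (∀ P : PlaceOver K F, 0 < P.ord f → P.ord f = 2) ∧
        (∀ P : PlaceOver K F, 0 < P.ord (f - 1) → P.ord (f - 1) = 3) ∧
        (∀ P : PlaceOver K F, P.ord f < 0 → P.ord f = -r) ∧
        (∀ π₀ : K[X], Irreducible π₀ → π₀.Monic → π₀ ≠ X → π₀ ≠ X - 1 →
          ∀ P : PlaceOver K F, 0 < P.ord (aeval f π₀) → P.ord (aeval f π₀) = 1))
    (hFaltings : ∀ (K' : Type) [Field K'] (F' : Type) [Field F'] [Algebra K' F'],
      finite_ratPlaces_of_two_le_genus K' F') :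
    PastenShimura2024_lemma_6_10 := by
  classical
  intro L hL S
  -- the least divisor `r ≥ 7` of `L`
  have hex : ∃ r : ℕ, r ∣ L ∧ 7 ≤ r := ⟨L, dvd_rfl, hL⟩
  obtain ⟨hrL, hr⟩ := Nat.find_spec hex
  have hmin : ∀ r' : ℕ, r' ∣ Nat.find hex → 7 ≤ r' → r' = Nat.find hex := fun r' hd h7 =>
    le_antisymm (Nat.le_of_dvd (by omega) hd) (Nat.find_min' hex ⟨hd.trans hrL, h7⟩)
  obtain ⟨K, _, _, F, _, _, _, _, f, hf, h₀, h₁, hi, hunr⟩ := hCover _ hr hmin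
  exact PastenLemma610.conductor_bounded_of_finite_properSolutions (by omega)
    (fun _ _ _ hA hB hC => PastenLemma610.finite_properSolutions_of_cover_of_faltings hr hrL
      (by omega) hf h₀ h₁ hi hunr hFaltings hA hB hC) S

/-- **The finiteness form `h610` of Lemma 6.10 from Faltings' theorem and coverings of the
signatures `(2, 3, r)` for the minimal `r ≥ 7` only** (same proof, through
`PastenLemma610.finite_minimalDiscriminantNorm_of_finite_properSolutions`).
[cite: PastenShimura2024, Lemma 6.10 (§6.5, p. 22), last paragraph of the proof]
[cite: DarmonGranville1995, Theorem 2 (p. 515), Prop. 3.1 (p. 525)] -/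
theorem finite_minimalDiscriminantNorm_of_signatureCovers_two_three_of_faltings
    (hCover : ∀ r : ℕ, 7 ≤ r → (∀ r' : ℕ, r' ∣ r → 7 ≤ r' → r' = r) →
      ∃ (K : Type) (_ : Field K) (_ : NumberField K) (F : Type) (_ : Field F) (_ : Algebra K F)
        (_ : IsAlgFunctionField K F) (_ : IsIntegrallyClosedIn K F) (f : F),
        f ∉ Set.range (algebraMap K F) ∧
        (∀ P : PlaceOver K F, 0 < P.ord f → P.ord f = 2) ∧
        (∀ P : PlaceOver K F, 0 < P.ord (f - 1) → P.ord (f - 1) = 3) ∧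
        (∀ P : PlaceOver K F, P.ord f < 0 → P.ord f = -r) ∧
        (∀ π₀ : K[X], Irreducible π₀ → π₀.Monic → π₀ ≠ X → π₀ ≠ X - 1 →
          ∀ P : PlaceOver K F, 0 < P.ord (aeval f π₀) → P.ord (aeval f π₀) = 1))
    (hFaltings : ∀ (K' : Type) [Field K'] (F' : Type) [Field F'] [Algebra K' F'],
      finite_ratPlaces_of_two_le_genus K' F') (S : Finset ℕ) :
    ∀ L : ℕ, 7 ≤ L → {Δ : ℕ | ∃ (W : WeierstrassCurve ℚ) (_ : W.IsElliptic),
        (∀ q : ℕ, q.Prime → q ∉ S → ¬ q ^ 2 ∣ W.conductorNorm ℤ) ∧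
        W.minimalDiscriminantNorm ℤ = Δ ∧
        ∃ n k : ℕ, (∀ q : ℕ, q.Prime → q ∣ n → q ∈ S) ∧ Δ = n * k ^ L}.Finite := by
  classical
  intro L hL
  have hex : ∃ r : ℕ, r ∣ L ∧ 7 ≤ r := ⟨L, dvd_rfl, hL⟩
  obtain ⟨hrL, hr⟩ := Nat.find_spec hex
  have hmin : ∀ r' : ℕ, r' ∣ Nat.find hex → 7 ≤ r' → r' = Nat.find hex := fun r' hd h7 =>
    le_antisymm (Nat.le_of_dvd (by omega) hd) (Nat.find_min' hex ⟨hd.trans hrL, h7⟩)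
  obtain ⟨K, _, _, F, _, _, _, _, f, hf, h₀, h₁, hi, hunr⟩ := hCover _ hr hmin
  exact PastenLemma610.finite_minimalDiscriminantNorm_of_finite_properSolutions (by omega)
    (fun _ _ _ hA hB hC => PastenLemma610.finite_properSolutions_of_cover_of_faltings hr hrL
      (by omega) hf h₀ h₁ hi hunr hFaltings hA hB hC) S

/-- The arithmetic minimality "`r ≥ 7` and every divisor `r' ≥ 7` of `r` equals `r`" is the
minimality of the sorted signature `(2, 3, r)` for coordinatewise divisibility among hyperbolic
signatures, as in `darmonGranville1995_thm_2_of_minimal_belyiMaps_of_faltings`: a hyperbolic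
`(p', q', r')` with `p' ∣ 2`, `q' ∣ 3` has `p' = 2`, `q' = 3` and `r' ≥ 7`. [folklore] -/
theorem PastenLemma610.minimal_two_three {r : ℕ} (hmin : ∀ r' : ℕ, r' ∣ r → 7 ≤ r' → r' = r) :
    ∀ p' q' r' : ℕ, p' ∣ 2 → q' ∣ 3 → r' ∣ r →
      q' * r' + r' * p' + p' * q' < p' * q' * r' → p' = 2 ∧ q' = 3 ∧ r' = r := by
  intro p' q' r' hp' hq' hr' hH
  rcases (Nat.dvd_prime Nat.prime_two).mp hp' with rfl | rfl <;>
    rcases (Nat.dvd_prime Nat.prime_three).mp hq' with rfl | rfl <;>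
    exact ⟨by omega, by omega, hmin r' hr' (by omega)⟩

/-- **Pasten's Lemma 6.10 from Faltings' theorem and the coverings for the minimal sorted
hyperbolic signatures** — fed by VERBATIM the binder `hCover` of
`darmonGranville1995_thm_2_of_minimal_belyiMaps_of_faltings` (of which only the signatures
`(2, 3, r)` are used). [cite: PastenShimura2024, Lemma 6.10 (§6.5, p. 22)]
[cite: DarmonGranville1995, Theorem 2 (p. 515), Prop. 3.1 (p. 525)] -/
theorem PastenShimura2024_lemma_6_10_of_minimal_belyiMaps_of_faltings
    (hCover : ∀ p q r : ℕ, p ≤ q → q ≤ r → q * r + r * p + p * q < p * q * r →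
      (∀ p' q' r' : ℕ, p' ∣ p → q' ∣ q → r' ∣ r → q' * r' + r' * p' + p' * q' < p' * q' * r' →
        p' = p ∧ q' = q ∧ r' = r) →
      ∃ (K : Type) (_ : Field K) (_ : NumberField K) (F : Type) (_ : Field F) (_ : Algebra K F)
        (_ : IsAlgFunctionField K F) (_ : IsIntegrallyClosedIn K F) (f : F),
        f ∉ Set.range (algebraMap K F) ∧
        (∀ P : PlaceOver K F, 0 < P.ord f → P.ord f = p) ∧
        (∀ P : PlaceOver K F, 0 < P.ord (f - 1) → P.ord (f - 1) = q) ∧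
        (∀ P : PlaceOver K F, P.ord f < 0 → P.ord f = -r) ∧
        (∀ π₀ : K[X], Irreducible π₀ → π₀.Monic → π₀ ≠ X → π₀ ≠ X - 1 →
          ∀ P : PlaceOver K F, 0 < P.ord (aeval f π₀) → P.ord (aeval f π₀) = 1))
    (hFaltings : ∀ (K' : Type) [Field K'] (F' : Type) [Field F'] [Algebra K' F'],
      finite_ratPlaces_of_two_le_genus K' F') :
    PastenShimura2024_lemma_6_10 :=
  PastenShimura2024_lemma_6_10_of_signatureCovers_two_three_of_faltings
    (fun r hr hmin => by
      obtain ⟨K, iK, iN, F, iF, iA, iAF, iIC, f, hf, h₀, h₁, hi, hunr⟩ :=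
        hCover 2 3 r (by norm_num) (by omega) (by omega) (PastenLemma610.minimal_two_three hmin)
      exact ⟨K, iK, iN, F, iF, iA, iAF, iIC, f, hf, (by exact_mod_cast h₀), (by exact_mod_cast h₁),
        hi, hunr⟩)
    hFaltings

/-- **The finiteness form `h610` of Lemma 6.10 from Faltings' theorem and the coverings for the
minimal sorted hyperbolic signatures** (VERBATIM the binder `hCover` of
`darmonGranville1995_thm_2_of_minimal_belyiMaps_of_faltings`).
[cite: PastenShimura2024, Lemma 6.10 (§6.5, p. 22), last paragraph of the proof]
[cite: DarmonGranville1995, Theorem 2 (p. 515), Prop. 3.1 (p. 525)] -/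
theorem finite_minimalDiscriminantNorm_of_minimal_belyiMaps_of_faltings
    (hCover : ∀ p q r : ℕ, p ≤ q → q ≤ r → q * r + r * p + p * q < p * q * r →
      (∀ p' q' r' : ℕ, p' ∣ p → q' ∣ q → r' ∣ r → q' * r' + r' * p' + p' * q' < p' * q' * r' →
        p' = p ∧ q' = q ∧ r' = r) →
      ∃ (K : Type) (_ : Field K) (_ : NumberField K) (F : Type) (_ : Field F) (_ : Algebra K F)
        (_ : IsAlgFunctionField K F) (_ : IsIntegrallyClosedIn K F) (f : F),
        f ∉ Set.range (algebraMap K F) ∧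
        (∀ P : PlaceOver K F, 0 < P.ord f → P.ord f = p) ∧
        (∀ P : PlaceOver K F, 0 < P.ord (f - 1) → P.ord (f - 1) = q) ∧
        (∀ P : PlaceOver K F, P.ord f < 0 → P.ord f = -r) ∧
        (∀ π₀ : K[X], Irreducible π₀ → π₀.Monic → π₀ ≠ X → π₀ ≠ X - 1 →
          ∀ P : PlaceOver K F, 0 < P.ord (aeval f π₀) → P.ord (aeval f π₀) = 1))
    (hFaltings : ∀ (K' : Type) [Field K'] (F' : Type) [Field F'] [Algebra K' F'],
      finite_ratPlaces_of_two_le_genus K' F') (S : Finset ℕ) :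
    ∀ L : ℕ, 7 ≤ L → {Δ : ℕ | ∃ (W : WeierstrassCurve ℚ) (_ : W.IsElliptic),
        (∀ q : ℕ, q.Prime → q ∉ S → ¬ q ^ 2 ∣ W.conductorNorm ℤ) ∧
        W.minimalDiscriminantNorm ℤ = Δ ∧
        ∃ n k : ℕ, (∀ q : ℕ, q.Prime → q ∣ n → q ∈ S) ∧ Δ = n * k ^ L}.Finite :=
  finite_minimalDiscriminantNorm_of_signatureCovers_two_three_of_faltings
    (fun r hr hmin => by
      obtain ⟨K, iK, iN, F, iF, iA, iAF, iIC, f, hf, h₀, h₁, hi, hunr⟩ :=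
        hCover 2 3 r (by norm_num) (by omega) (by omega) (PastenLemma610.minimal_two_three hmin)
      exact ⟨K, iK, iN, F, iF, iA, iAF, iIC, f, hf, (by exact_mod_cast h₀), (by exact_mod_cast h₁),
        hi, hunr⟩)
    hFaltings S

end Literature.NumberTheory.EllipticCurves
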